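import Mathlib
import HarnessLib
import Summits.Langlands.Langlands.Theses.RuelleTorsionArtinWeight

/-!
# Birth skeleton (BC3) for crux stmt-Langlands-11056
`Summit.Langlands.Langlands.Theses.RuelleTorsionArtinWeight.ArtinPointsBianchi` — line `birth`

Route `route-Langlands-RuelleTorsionArtinWeight` (crux #3, rank 3).  The crux: for every imaginary
quadratic `K`, every prime `p` and every irreducible `σ : Γ_K → GL₂(ℚ̄_p)` with FINITE image, `σ` is
`p`-adically automorphic of some `S`-good tame level — its Frobenius eigensystem
`a = (a_{v,1}, a_{v,2})_{v ∉ S}` (pinned by Hansen association, `IsHeckeAssociatedAt`) is a continuous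
`𝒪_{ℚ̄_p}`-valued point of `Spf 𝕋(U^p)`, the big Hecke algebra of Emerton's completed cohomology of the
`p`-power Bianchi tower `U ∩ Γ(p^r)` (generic `IsHeckePoint`: for every `t`, `T_{v,i} ↦ a_{v,i}` extends to
a continuous `𝒪`-algebra map `𝕋(U^p) → 𝒪/p^t`; torsion eigensystems allowed).

The crux's own `why it might fail` names the TWO PILLARS that every known route to such an occurrence
statement stands on ("Both pillars open over K: residual modularity of σ̄ (Serre/K) and big R = 𝕋(K^p)_𝔪
in defect l₀ = 1"), and this skeleton is exactly that cut — torsion-friendly on both sides, never through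
characteristic-0 regular approximants (the dead line of the retired route `BianchiArtinPoints`,
obstructed off base-change/CM components by Calegari–Mazur 2009 Thm 1.1 / Cor 1.4):

* `stub_serreK` — **Serre's conjecture over `K`, completed/torsion form (the residual pillar).**  For
  `σ` as in the crux there is an `S`-good level `U` (same level package as the crux: `S ⊇ {v ∣ p}`, `U`
  open, `≤ GL₂(𝒪̂_K)`, full at `v ∉ S`, free at `S`; uniformisers `ϖ_v`) and an `𝒪`-valued eigensystem
  `a` Hansen-associated with `σ` off `S`, whose REDUCTION modulo the maximal ideal of `𝒪 = 𝒪_{ℚ̄_p}` is a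
  point of `𝕋(U^p) ⊗ 𝔽̄_p`: `T_{v,i} ↦ ā_{v,i}` extends to an `𝒪`-algebra map `𝕋(U^p) → 𝔽̄_p = 𝒪/𝔪`
  factoring through finitely many `H^i(X_{U_r}, 𝒪/p^t)` — i.e. `𝔪_σ̄ := ker` is a maximal ideal of the
  big Hecke algebra; torsion classes allowed, any degree.  For `σ̄` absolutely irreducible this is the
  (weak, level-free-at-`S`) Serre conjecture over imaginary quadratic fields (Figueiredo 1999, Şengün,
  Torrey 2012: numerics only); for `σ̄^{ss}` reducible it is the occurrence of Eisenstein systems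
  (degree `0` / boundary), so the stub is uniform in the residual type.
* `stub_artinLift` — **pro-modularity lifting at the Artin point (the `R = 𝕋` pillar).**  If the
  reduction of the eigensystem of a finite-image irreducible `σ` occurs in this sense at SOME `S`-good
  level, then `σ` itself is a point of `Spf 𝕋(U'^p)` at some (possibly deeper at `S'`, `S' ⊇ S ∪ …`)
  `S'`-good level: the conclusion of the crux verbatim.  Informal content: big `R_{S}(σ̄) ↠ 𝕋(U^p)_𝔪` is
  an isomorphism in defect `l₀ = 1` (Calegari–Geraghty, Gee–Newton Conj., Hansen Conj. 1.2.3), read at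
  the torsion-free but non-classical point `σ`; the ROUTE's mechanism for exactly this step is the
  torsion-growth detector (layer-2 items ArtinTorsionExcess → WeightPointFromTorsionGrowth at `𝔪 = 𝔪_σ̄`,
  which presuppose the maximal ideal `𝔪_σ̄` delivered by `stub_serreK`).  The level is NOT kept: a point
  of `𝕋(U^p)` has conductor at `v ∈ S ∖ {v ∣ p}` bounded by `U_v`, so same-level lifting is false in
  general; the stub re-chooses `(S, U, ϖ, a)`.
* `ArtinPointsBianchi_of` — the composition, kernel-checked (pointwise modus ponens in `(K, p, σ)`);
  concludes the route decl BY NAME.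

Both stubs are implied by the crux (`stub_artinLift_of_crux` is a λ-drop; `stub_serreK_of_crux`
composes the `t = 1` stage `𝕋 → 𝒪/p` with `𝒪/p → 𝒪/𝔪`, using `p ∈ 𝔪`, `PadicAlgCl.valuation_p`), hence
irrefutable short of refuting the crux; neither gives the crux or the summit cheaply (BC3 probes, card).

Disproof used: none on file for this crux (`ledger crux ls stmt-Langlands-11056`: no workfiles, no
`Disproof.lean`, no `Negative/` lemmas, 2026-08-17).  Sibling findings honoured: the Disproof of
`TwoAdicBianchiProModularityLevel` (ParityBlindBianchi) records that (a) `IsHeckePoint` has no empty-product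
loophole for `ϖ = p` non-unit and (b) degree `0` carries only degree-character (Eisenstein) points — which is
why `stub_serreK` is phrased modulo `𝔪` (a genuine residual eigensystem, not the `p`-thickened `t = 1`
stage) and why its Eisenstein case is honest rather than vacuous.

Shape (for `ledger skeleton check`): stubs `theorem stub_<name> : <signature> := by sorry` stated over
tree declarations only (`FramedGaloisRep`, `IsHeckePoint`, `bigHeckeAlgebra`, `towerHeckeFamily`,
`LevelTower.ofSeq`, `principalCongruenceLevel`, `GLn.sndHom`, `heckeDiagAt`, `glFiniteIntegralLevel`,
`FramedGaloisRep.IsHeckeAssociatedAt`, Mathlib `IsLocalRing.maximalIdeal` / `Ideal.Quotient.mk`);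
`_Goal.stub_<name> : Prop := type_of% @stub_<name>` names each statement; the composition
`ArtinPointsBianchi_of (h₁ : _Goal.stub_serreK) (h₂ : _Goal.stub_artinLift) : ArtinPointsBianchi` is
proved without `sorry`.
-/

set_option linter.dupNamespace false
set_option linter.unusedVariables false

noncomputable section

namespace Summit.Langlands.Langlands.Cruxes.ArtinPointsBianchi.Birth

open Summit.Langlands Summit.Langlands.Langlands.Theses.RuelleTorsionArtinWeight
open Literature.NumberTheory.Automorphic Literature.NumberTheory.GaloisRepresentations
open NumberField IsDedekindDomain
open scoped NumberField

universe u v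

/-! ## 0. Vocabulary (documentation only; the stubs below are written out over tree declarations) -/

section Generic

variable {k : Type u} [CommRing k] [IsLocalRing k] {Γ 𝒢 : Type u} [Group Γ] [Group 𝒢]
  (ι : Γ →* 𝒢) (T : LevelTower 𝒢) (ϖ : k) {J : Type v} (δ : J → 𝒢) (χ : J → k)

/-- **`χ mod 𝔪_k` is a point of `Spec 𝕋(Kᵖ) ⊗ k/𝔪_k`** (residual form of the tree's `IsHeckePoint`, for a
local coefficient ring `k`): the assignment `T_{δ j} ↦ χ j mod 𝔪_k` extends to a `k`-algebra homomorphism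
`𝕋(Kᵖ) → k/𝔪_k` which is continuous, i.e. factors through finitely many of the `H^i(X_{K(s)}, k/ϖ^t)`.
Equivalently: the residual eigensystem `χ̄` is that of a maximal ideal `𝔪 = ker` of the big Hecke algebra
with `𝕋/𝔪 ↪ k/𝔪_k`.  [cite: CalegariEmerton2011, §8] -/
def IsResidualHeckePoint : Prop :=
  ∃ (I : Finset TowerIndex) (φ : bigHeckeAlgebra k ι T ϖ δ →ₐ[k] k ⧸ IsLocalRing.maximalIdeal k),
    (∀ x y : bigHeckeAlgebra k ι T ϖ δ, (∀ z ∈ I, x.1 z = y.1 z) → φ x = φ y) ∧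
      ∀ j, φ ⟨towerHeckeFamily k ι T ϖ (δ j), towerHeckeFamily_mem_bigHeckeAlgebra k ι T ϖ δ j⟩ =
        Ideal.Quotient.mk (IsLocalRing.maximalIdeal k) (χ j)

/-- **A point of `Spf 𝕋(Kᵖ)` reduces to a residual point** whenever `ϖ ∈ 𝔪_k` (compose the stage `t = 1`,
`𝕋 → k/ϖ`, with `k/ϖ → k/𝔪_k`). [folklore] -/
theorem IsResidualHeckePoint.of_isHeckePoint (hϖ : ϖ ∈ IsLocalRing.maximalIdeal k)
    (h : IsHeckePoint ι T ϖ δ χ) : IsResidualHeckePoint ι T ϖ δ χ := by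
  obtain ⟨I, φ, hcont, hgen⟩ := h 1
  have hle : Ideal.span {ϖ ^ 1} ≤ IsLocalRing.maximalIdeal k := by
    rw [pow_one, Ideal.span_singleton_le_iff_mem]
    exact hϖ
  refine ⟨I, (Ideal.Quotient.factorₐ k hle).comp φ, fun x y hxy => ?_, fun j => ?_⟩
  · rw [AlgHom.comp_apply, AlgHom.comp_apply, hcont x y hxy]
  · rw [AlgHom.comp_apply, hgen j]
    exact Ideal.Quotient.factorₐ_apply_mk k hle (χ j)

end Generic

section Vocabulary

variable (K : Type) [Field K] [NumberField K] (p : ℕ) [Fact p.Prime]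

/-- **`σ` is `p`-adically automorphic of some `S`-good tame level** — the conclusion of the crux for
`(K, p, σ)`, verbatim (see `artinPointsBianchi_iff`). [cite: HansenUniversalEigenvarieties2017, Def. 1.2.1 and Conj. 1.2.3] -/
def Occurs (σ : FramedGaloisRep K (PadicAlgCl p) 2) : Prop :=
  ∃ (S : Finset (HeightOneSpectrum (𝓞 K)))
    (U : Subgroup (GL (Fin 2) (FiniteAdeleRing (𝓞 K) K)))
    (ϖ : ∀ v : HeightOneSpectrum (𝓞 K), (v.adicCompletion K)ˣ)
    (a : {v : HeightOneSpectrum (𝓞 K) // v ∉ S} → ℕ → (Valued.v (R := PadicAlgCl p)).valuationSubring),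
    (∀ v : HeightOneSpectrum (𝓞 K), ((p : ℕ) : 𝓞 K) ∈ v.asIdeal → v ∈ S) ∧
    IsOpen (U : Set (GL (Fin 2) (FiniteAdeleRing (𝓞 K) K))) ∧
    U ≤ glFiniteIntegralLevel 2 K ∧
    (∀ g ∈ glFiniteIntegralLevel 2 K, (∀ v ∈ S, ∀ i j : Fin 2,
        ((g : Matrix (Fin 2) (Fin 2) (FiniteAdeleRing (𝓞 K) K)) i j) v =
          (1 : Matrix (Fin 2) (Fin 2) (v.adicCompletion K)) i j) → g ∈ U) ∧
    (∀ v : HeightOneSpectrum (𝓞 K),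
        Valued.v ((ϖ v : (v.adicCompletion K)ˣ) : v.adicCompletion K) = WithZero.exp (-1 : ℤ)) ∧
    IsHeckePoint
      (Matrix.GeneralLinearGroup.map (n := Fin 2) (algebraMap K (FiniteAdeleRing (𝓞 K) K)))
      (LevelTower.ofSeq U (fun r : ℕ =>
        (principalCongruenceLevel 2 K (Ideal.span {((p : ℕ) : 𝓞 K)} ^ r)).map (GLn.sndHom 2 K)))
      ((p : ℕ) : (Valued.v (R := PadicAlgCl p)).valuationSubring)
      (fun j : {v : HeightOneSpectrum (𝓞 K) // v ∉ S} × Fin 2 =>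
        GLn.sndHom 2 K (heckeDiagAt 2 K j.1.1 (ϖ j.1.1) (j.2.val + 1)))
      (fun j => a j.1 (j.2.val + 1)) ∧
    ∀ (v : HeightOneSpectrum (𝓞 K)) (hv : v ∉ S), σ.IsHeckeAssociatedAt v
      (fun i : ℕ => if i = 0 then (1 : PadicAlgCl p)
        else ((a ⟨v, hv⟩ i : (Valued.v (R := PadicAlgCl p)).valuationSubring) : PadicAlgCl p))

/-- **The reduction of `σ`'s eigensystem occurs in the completed cohomology of some `S`-good level**
(residual occurrence): the level package of `Occurs` verbatim, with the point clause replaced by its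
residual form `IsResidualHeckePoint` (an `𝒪`-algebra map `𝕋(U^p) → 𝒪/𝔪 = 𝔽̄_p` through finitely many
pieces, `T_{v,i} ↦ ā_{v,i}`), the eigensystem `a` still Hansen-associated with `σ` off `S` in
characteristic `0` (so `ā` IS the eigensystem of `σ̄^{ss}`).  [cite: HansenUniversalEigenvarieties2017, Def. 1.2.1] -/
def ResiduallyOccurs (σ : FramedGaloisRep K (PadicAlgCl p) 2) : Prop :=
  ∃ (S : Finset (HeightOneSpectrum (𝓞 K)))
    (U : Subgroup (GL (Fin 2) (FiniteAdeleRing (𝓞 K) K)))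
    (ϖ : ∀ v : HeightOneSpectrum (𝓞 K), (v.adicCompletion K)ˣ)
    (a : {v : HeightOneSpectrum (𝓞 K) // v ∉ S} → ℕ → (Valued.v (R := PadicAlgCl p)).valuationSubring),
    (∀ v : HeightOneSpectrum (𝓞 K), ((p : ℕ) : 𝓞 K) ∈ v.asIdeal → v ∈ S) ∧
    IsOpen (U : Set (GL (Fin 2) (FiniteAdeleRing (𝓞 K) K))) ∧
    U ≤ glFiniteIntegralLevel 2 K ∧
    (∀ g ∈ glFiniteIntegralLevel 2 K, (∀ v ∈ S, ∀ i j : Fin 2,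
        ((g : Matrix (Fin 2) (Fin 2) (FiniteAdeleRing (𝓞 K) K)) i j) v =
          (1 : Matrix (Fin 2) (Fin 2) (v.adicCompletion K)) i j) → g ∈ U) ∧
    (∀ v : HeightOneSpectrum (𝓞 K),
        Valued.v ((ϖ v : (v.adicCompletion K)ˣ) : v.adicCompletion K) = WithZero.exp (-1 : ℤ)) ∧
    IsResidualHeckePoint
      (Matrix.GeneralLinearGroup.map (n := Fin 2) (algebraMap K (FiniteAdeleRing (𝓞 K) K)))
      (LevelTower.ofSeq U (fun r : ℕ =>
        (principalCongruenceLevel 2 K (Ideal.span {((p : ℕ) : 𝓞 K)} ^ r)).map (GLn.sndHom 2 K)))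
      ((p : ℕ) : (Valued.v (R := PadicAlgCl p)).valuationSubring)
      (fun j : {v : HeightOneSpectrum (𝓞 K) // v ∉ S} × Fin 2 =>
        GLn.sndHom 2 K (heckeDiagAt 2 K j.1.1 (ϖ j.1.1) (j.2.val + 1)))
      (fun j => a j.1 (j.2.val + 1)) ∧
    ∀ (v : HeightOneSpectrum (𝓞 K)) (hv : v ∉ S), σ.IsHeckeAssociatedAt v
      (fun i : ℕ => if i = 0 then (1 : PadicAlgCl p)
        else ((a ⟨v, hv⟩ i : (Valued.v (R := PadicAlgCl p)).valuationSubring) : PadicAlgCl p))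

end Vocabulary

/-- The crux unfolded over the vocabulary (definitional). [folklore] -/
theorem artinPointsBianchi_iff :
    ArtinPointsBianchi ↔
      ∀ (K : Type) [Field K] [NumberField K], IsTotallyComplex K → Module.finrank ℚ K = 2 →
        ∀ (p : ℕ) [Fact p.Prime] (σ : FramedGaloisRep K (PadicAlgCl p) 2),
          Finite σ.toMonoidHom.range → σ.toGaloisRep.IsIrreducible → Occurs K p σ :=
  Iff.rfl

/-- `p` lies in the maximal ideal of `𝒪 = 𝒪_{ℚ̄_p}` (`v(p) = 1/p < 1`). [folklore] -/
theorem natCast_mem_maximalIdeal (p : ℕ) [Fact p.Prime] :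
    ((p : ℕ) : (Valued.v (R := PadicAlgCl p)).valuationSubring) ∈
      IsLocalRing.maximalIdeal (Valued.v (R := PadicAlgCl p)).valuationSubring := by
  rw [IsLocalRing.mem_maximalIdeal, mem_nonunits_iff]
  intro hu
  have h1 := (Valuation.valuationSubring.integers (v := Valued.v (R := PadicAlgCl p))).one_of_isUnit hu
  have h2 : (algebraMap ((Valued.v (R := PadicAlgCl p)).valuationSubring) (PadicAlgCl p))
      ((p : ℕ) : (Valued.v (R := PadicAlgCl p)).valuationSubring) = (p : PadicAlgCl p) :=
    map_natCast _ p
  rw [h2, PadicAlgCl.valuation_p p, one_div, inv_eq_one] at h1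
  have hp : (1 : NNReal) < (p : NNReal) := by exact_mod_cast (Fact.out : p.Prime).one_lt
  exact absurd h1 hp.ne'

/-- Occurrence implies residual occurrence (same level package; `t = 1` stage composed with
`𝒪/p → 𝒪/𝔪`). [folklore] -/
theorem residuallyOccurs_of_occurs (K : Type) [Field K] [NumberField K] (p : ℕ) [Fact p.Prime]
    (σ : FramedGaloisRep K (PadicAlgCl p) 2) (h : Occurs K p σ) : ResiduallyOccurs K p σ := by
  obtain ⟨S, U, ϖ, a, hS, hUo, hUle, hUS, hϖ, hpt, hass⟩ := h
  exact ⟨S, U, ϖ, a, hS, hUo, hUle, hUS, hϖ,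
    IsResidualHeckePoint.of_isHeckePoint _ _ _ _ _ (natCast_mem_maximalIdeal p) hpt, hass⟩

/-! ## 1. The two stubs -/

/-- **STUB 1 — Serre's conjecture over the imaginary quadratic field `K`, completed/torsion form
(residual occurrence of `σ̄`).**  For `K` imaginary quadratic, `p` any prime and `σ : Γ_K → GL₂(ℚ̄_p)`
irreducible with finite image, there are a finite `S ⊇ {v ∣ p}`, an `S`-good level `U` (open,
`≤ GL₂(𝒪̂_K)`, containing every integral `g` with `g_v = 1` for `v ∈ S`), uniformisers `ϖ_v` and an
`𝒪_{ℚ̄_p}`-valued eigensystem `a` Hansen-associated with `σ` at every `v ∉ S` (so `a_{v,1} = tr σ(Frob_v⁻¹)`,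
`q_v a_{v,2} = det σ(Frob_v⁻¹)`) such that `T_{v,i} ↦ a_{v,i} mod 𝔪` extends to an `𝒪`-algebra map from the
big Hecke algebra `𝕋(U^p)` of the `p`-power Bianchi tower (acting on `⊕_{i,r,t} H^i(X_{U ∩ Γ(p^r)}, 𝒪/p^t)`)
to `𝒪/𝔪 = 𝔽̄_p`, factoring through finitely many pieces: the residual eigensystem of `σ` is that of a
maximal ideal `𝔪_σ̄` of `𝕋(U^p)`.  Absolutely irreducible `σ̄`: Serre's modularity conjecture over `K`
(mod `p` Bianchi cohomology classes, torsion ones included; all Serre weights are absorbed by the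
`p`-power tower with trivial coefficients), numerically tested, open (no odd/even, no Khare–Wintenberger
over `K`).  Reducible `σ̄^{ss} = χ̄₁ ⊕ χ̄₂`: Eisenstein systems (degree-`0` degree characters
`ψ ⊕ ψ ω⁻¹`, boundary/Eisenstein cohomology in general) — expected provable.  Size: XL (open conjecture
in the irreducible case).  Implied by the crux (`stub_serreK_of_crux`).
[cite: CalegariEmerton2011, §8] [cite: Scholze2015, §V.4, Cor. V.4.3] [cite: HansenUniversalEigenvarieties2017, Def. 1.2.1]
(Serre over imaginary quadratic fields: Figueiredo 1999, doi:10.1080/10586458.1999.10504395; Torrey 2012,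
doi:10.1016/j.jnt.2011.09.010; Şengün 2011 survey arXiv:1104.3318.) -/
theorem stub_serreK :
    ∀ (K : Type) [Field K] [NumberField K], IsTotallyComplex K → Module.finrank ℚ K = 2 →
      ∀ (p : ℕ) [Fact p.Prime] (σ : FramedGaloisRep K (PadicAlgCl p) 2),
        Finite σ.toMonoidHom.range → σ.toGaloisRep.IsIrreducible →
        ∃ (S : Finset (HeightOneSpectrum (𝓞 K)))
          (U : Subgroup (GL (Fin 2) (FiniteAdeleRing (𝓞 K) K)))
          (ϖ : ∀ v : HeightOneSpectrum (𝓞 K), (v.adicCompletion K)ˣ)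
          (a : {v : HeightOneSpectrum (𝓞 K) // v ∉ S} → ℕ →
            (Valued.v (R := PadicAlgCl p)).valuationSubring),
          (∀ v : HeightOneSpectrum (𝓞 K), ((p : ℕ) : 𝓞 K) ∈ v.asIdeal → v ∈ S) ∧
          IsOpen (U : Set (GL (Fin 2) (FiniteAdeleRing (𝓞 K) K))) ∧
          U ≤ glFiniteIntegralLevel 2 K ∧
          (∀ g ∈ glFiniteIntegralLevel 2 K, (∀ v ∈ S, ∀ i j : Fin 2,
              ((g : Matrix (Fin 2) (Fin 2) (FiniteAdeleRing (𝓞 K) K)) i j) v =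
                (1 : Matrix (Fin 2) (Fin 2) (v.adicCompletion K)) i j) → g ∈ U) ∧
          (∀ v : HeightOneSpectrum (𝓞 K),
              Valued.v ((ϖ v : (v.adicCompletion K)ˣ) : v.adicCompletion K) = WithZero.exp (-1 : ℤ)) ∧
          (∃ (I : Finset TowerIndex)
              (φ : bigHeckeAlgebra (Valued.v (R := PadicAlgCl p)).valuationSubring
                  (Matrix.GeneralLinearGroup.map (n := Fin 2) (algebraMap K (FiniteAdeleRing (𝓞 K) K)))
                  (LevelTower.ofSeq U (fun r : ℕ =>
                    (principalCongruenceLevel 2 K (Ideal.span {((p : ℕ) : 𝓞 K)} ^ r)).map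
                      (GLn.sndHom 2 K)))
                  ((p : ℕ) : (Valued.v (R := PadicAlgCl p)).valuationSubring)
                  (fun j : {v : HeightOneSpectrum (𝓞 K) // v ∉ S} × Fin 2 =>
                    GLn.sndHom 2 K (heckeDiagAt 2 K j.1.1 (ϖ j.1.1) (j.2.val + 1))) →ₐ[
                    (Valued.v (R := PadicAlgCl p)).valuationSubring]
                (↥(Valued.v (R := PadicAlgCl p)).valuationSubring ⧸
                  IsLocalRing.maximalIdeal ↥(Valued.v (R := PadicAlgCl p)).valuationSubring)),
              (∀ x y, (∀ z ∈ I, x.1 z = y.1 z) → φ x = φ y) ∧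
              ∀ j : {v : HeightOneSpectrum (𝓞 K) // v ∉ S} × Fin 2,
                φ ⟨towerHeckeFamily ((Valued.v (R := PadicAlgCl p)).valuationSubring)
                    (Matrix.GeneralLinearGroup.map (n := Fin 2) (algebraMap K (FiniteAdeleRing (𝓞 K) K)))
                    (LevelTower.ofSeq U (fun r : ℕ =>
                      (principalCongruenceLevel 2 K (Ideal.span {((p : ℕ) : 𝓞 K)} ^ r)).map
                        (GLn.sndHom 2 K)))
                    ((p : ℕ) : (Valued.v (R := PadicAlgCl p)).valuationSubring)
                    (GLn.sndHom 2 K (heckeDiagAt 2 K j.1.1 (ϖ j.1.1) (j.2.val + 1))),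
                  towerHeckeFamily_mem_bigHeckeAlgebra _ _ _ _
                    (fun j : {v : HeightOneSpectrum (𝓞 K) // v ∉ S} × Fin 2 =>
                      GLn.sndHom 2 K (heckeDiagAt 2 K j.1.1 (ϖ j.1.1) (j.2.val + 1))) j⟩ =
                  Ideal.Quotient.mk (IsLocalRing.maximalIdeal _) (a j.1 (j.2.val + 1))) ∧
          ∀ (v : HeightOneSpectrum (𝓞 K)) (hv : v ∉ S), σ.IsHeckeAssociatedAt v
            (fun i : ℕ => if i = 0 then (1 : PadicAlgCl p)
              else ((a ⟨v, hv⟩ i : (Valued.v (R := PadicAlgCl p)).valuationSubring) : PadicAlgCl p)) := by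
  sorry

/-- **STUB 2 — pro-modularity lifting at the Artin point (residual occurrence ⟹ occurrence).**  For `K`
imaginary quadratic, `p` any prime and `σ : Γ_K → GL₂(ℚ̄_p)` irreducible with finite image: if the
reduction of `σ`'s eigensystem occurs in the completed cohomology of SOME `S`-good level (the conclusion of
`stub_serreK` verbatim), then `σ` is `p`-adically automorphic of some `S'`-good tame level — the conclusion
of the crux verbatim (a continuous `𝒪_{ℚ̄_p}`-point of `Spf 𝕋(U'^p)`, `IsHeckePoint`, Hansen-associated with
`σ` off `S'`; the level is re-chosen, since a point of `𝕋(U^p)` has conductor at `v ∈ S ∖ {v ∣ p}` bounded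
by `U_v`).  Informal content: big `R_S(σ̄) = 𝕋(U^p)_{𝔪_σ̄}` for `GL₂/K` in defect `l₀ = 1` (conditional:
Gee–Newton, Calegari–Geraghty; `p`-adic/torsion local–global compatibility over `F = K` excluded by
Caraiani–Newton Rem. 1.3.1), or Hansen's Conj. 1.2.3, read at the point `σ`; residually Eisenstein `σ`
need the pseudo-deformation (`R^{ps} = 𝕋_𝔪`, Skinner–Wiles / Wake–Wang-Erickson type) variant.  THIS is
the step the route's torsion-growth mechanism (layer 2: `𝔪_σ̄`-localised torsion of `H₁(Γ₀(𝔫), V_{λ_m})`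
unbounded along `λ_m → (−1,−1)` ⟹ a weight-`(−1,−1)` point of `𝕋(K^p)_{𝔪_σ̄}`) is designed to prove
WITHOUT `R = 𝕋`.  Size: XL (open problem).  Implied by the crux (`stub_artinLift_of_crux`).
[cite: GeeNewton2020, Conj. 3.3.2 and Def. 3.3.4] [cite: CalegariGeraghty2017, §1]
[cite: HansenUniversalEigenvarieties2017, Conj. 1.2.3] [cite: CaraianiNewton2023, Rem. 1.3.1]
[cite: CalegariEmerton2011, §8] -/
theorem stub_artinLift :
    ∀ (K : Type) [Field K] [NumberField K], IsTotallyComplex K → Module.finrank ℚ K = 2 →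
      ∀ (p : ℕ) [Fact p.Prime] (σ : FramedGaloisRep K (PadicAlgCl p) 2),
        Finite σ.toMonoidHom.range → σ.toGaloisRep.IsIrreducible →
        (∃ (S : Finset (HeightOneSpectrum (𝓞 K)))
          (U : Subgroup (GL (Fin 2) (FiniteAdeleRing (𝓞 K) K)))
          (ϖ : ∀ v : HeightOneSpectrum (𝓞 K), (v.adicCompletion K)ˣ)
          (a : {v : HeightOneSpectrum (𝓞 K) // v ∉ S} → ℕ →
            (Valued.v (R := PadicAlgCl p)).valuationSubring),
          (∀ v : HeightOneSpectrum (𝓞 K), ((p : ℕ) : 𝓞 K) ∈ v.asIdeal → v ∈ S) ∧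
          IsOpen (U : Set (GL (Fin 2) (FiniteAdeleRing (𝓞 K) K))) ∧
          U ≤ glFiniteIntegralLevel 2 K ∧
          (∀ g ∈ glFiniteIntegralLevel 2 K, (∀ v ∈ S, ∀ i j : Fin 2,
              ((g : Matrix (Fin 2) (Fin 2) (FiniteAdeleRing (𝓞 K) K)) i j) v =
                (1 : Matrix (Fin 2) (Fin 2) (v.adicCompletion K)) i j) → g ∈ U) ∧
          (∀ v : HeightOneSpectrum (𝓞 K),
              Valued.v ((ϖ v : (v.adicCompletion K)ˣ) : v.adicCompletion K) = WithZero.exp (-1 : ℤ)) ∧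
          (∃ (I : Finset TowerIndex)
              (φ : bigHeckeAlgebra (Valued.v (R := PadicAlgCl p)).valuationSubring
                  (Matrix.GeneralLinearGroup.map (n := Fin 2) (algebraMap K (FiniteAdeleRing (𝓞 K) K)))
                  (LevelTower.ofSeq U (fun r : ℕ =>
                    (principalCongruenceLevel 2 K (Ideal.span {((p : ℕ) : 𝓞 K)} ^ r)).map
                      (GLn.sndHom 2 K)))
                  ((p : ℕ) : (Valued.v (R := PadicAlgCl p)).valuationSubring)
                  (fun j : {v : HeightOneSpectrum (𝓞 K) // v ∉ S} × Fin 2 =>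
                    GLn.sndHom 2 K (heckeDiagAt 2 K j.1.1 (ϖ j.1.1) (j.2.val + 1))) →ₐ[
                    (Valued.v (R := PadicAlgCl p)).valuationSubring]
                (↥(Valued.v (R := PadicAlgCl p)).valuationSubring ⧸
                  IsLocalRing.maximalIdeal ↥(Valued.v (R := PadicAlgCl p)).valuationSubring)),
              (∀ x y, (∀ z ∈ I, x.1 z = y.1 z) → φ x = φ y) ∧
              ∀ j : {v : HeightOneSpectrum (𝓞 K) // v ∉ S} × Fin 2,
                φ ⟨towerHeckeFamily ((Valued.v (R := PadicAlgCl p)).valuationSubring)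
                    (Matrix.GeneralLinearGroup.map (n := Fin 2) (algebraMap K (FiniteAdeleRing (𝓞 K) K)))
                    (LevelTower.ofSeq U (fun r : ℕ =>
                      (principalCongruenceLevel 2 K (Ideal.span {((p : ℕ) : 𝓞 K)} ^ r)).map
                        (GLn.sndHom 2 K)))
                    ((p : ℕ) : (Valued.v (R := PadicAlgCl p)).valuationSubring)
                    (GLn.sndHom 2 K (heckeDiagAt 2 K j.1.1 (ϖ j.1.1) (j.2.val + 1))),
                  towerHeckeFamily_mem_bigHeckeAlgebra _ _ _ _
                    (fun j : {v : HeightOneSpectrum (𝓞 K) // v ∉ S} × Fin 2 =>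
                      GLn.sndHom 2 K (heckeDiagAt 2 K j.1.1 (ϖ j.1.1) (j.2.val + 1))) j⟩ =
                  Ideal.Quotient.mk (IsLocalRing.maximalIdeal _) (a j.1 (j.2.val + 1))) ∧
          ∀ (v : HeightOneSpectrum (𝓞 K)) (hv : v ∉ S), σ.IsHeckeAssociatedAt v
            (fun i : ℕ => if i = 0 then (1 : PadicAlgCl p)
              else ((a ⟨v, hv⟩ i : (Valued.v (R := PadicAlgCl p)).valuationSubring) : PadicAlgCl p))) →
        ∃ (S : Finset (HeightOneSpectrum (𝓞 K)))
          (U : Subgroup (GL (Fin 2) (FiniteAdeleRing (𝓞 K) K)))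
          (ϖ : ∀ v : HeightOneSpectrum (𝓞 K), (v.adicCompletion K)ˣ)
          (a : {v : HeightOneSpectrum (𝓞 K) // v ∉ S} → ℕ →
            (Valued.v (R := PadicAlgCl p)).valuationSubring),
          (∀ v : HeightOneSpectrum (𝓞 K), ((p : ℕ) : 𝓞 K) ∈ v.asIdeal → v ∈ S) ∧
          IsOpen (U : Set (GL (Fin 2) (FiniteAdeleRing (𝓞 K) K))) ∧
          U ≤ glFiniteIntegralLevel 2 K ∧
          (∀ g ∈ glFiniteIntegralLevel 2 K, (∀ v ∈ S, ∀ i j : Fin 2,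
              ((g : Matrix (Fin 2) (Fin 2) (FiniteAdeleRing (𝓞 K) K)) i j) v =
                (1 : Matrix (Fin 2) (Fin 2) (v.adicCompletion K)) i j) → g ∈ U) ∧
          (∀ v : HeightOneSpectrum (𝓞 K),
              Valued.v ((ϖ v : (v.adicCompletion K)ˣ) : v.adicCompletion K) = WithZero.exp (-1 : ℤ)) ∧
          IsHeckePoint
            (Matrix.GeneralLinearGroup.map (n := Fin 2) (algebraMap K (FiniteAdeleRing (𝓞 K) K)))
            (LevelTower.ofSeq U (fun r : ℕ =>
              (principalCongruenceLevel 2 K (Ideal.span {((p : ℕ) : 𝓞 K)} ^ r)).map (GLn.sndHom 2 K)))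
            ((p : ℕ) : (Valued.v (R := PadicAlgCl p)).valuationSubring)
            (fun j : {v : HeightOneSpectrum (𝓞 K) // v ∉ S} × Fin 2 =>
              GLn.sndHom 2 K (heckeDiagAt 2 K j.1.1 (ϖ j.1.1) (j.2.val + 1)))
            (fun j => a j.1 (j.2.val + 1)) ∧
          ∀ (v : HeightOneSpectrum (𝓞 K)) (hv : v ∉ S), σ.IsHeckeAssociatedAt v
            (fun i : ℕ => if i = 0 then (1 : PadicAlgCl p)
              else ((a ⟨v, hv⟩ i : (Valued.v (R := PadicAlgCl p)).valuationSubring) : PadicAlgCl p)) := by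
  sorry

/-! ## 2. The stub statements as named `Prop`s (literally their types) -/

namespace _Goal

/-- The statement of `stub_serreK`, as a named `Prop` (literally its type). [folklore] -/
def stub_serreK : Prop :=
  type_of% @Summit.Langlands.Langlands.Cruxes.ArtinPointsBianchi.Birth.stub_serreK

/-- The statement of `stub_artinLift`, as a named `Prop` (literally its type). [folklore] -/
def stub_artinLift : Prop :=
  type_of% @Summit.Langlands.Langlands.Cruxes.ArtinPointsBianchi.Birth.stub_artinLift

end _Goal

/-- The two named statements over this file's vocabulary (definitional). [folklore] -/
theorem goals_iff :
    (_Goal.stub_serreK ↔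
      ∀ (K : Type) [Field K] [NumberField K], IsTotallyComplex K → Module.finrank ℚ K = 2 →
        ∀ (p : ℕ) [Fact p.Prime] (σ : FramedGaloisRep K (PadicAlgCl p) 2),
          Finite σ.toMonoidHom.range → σ.toGaloisRep.IsIrreducible → ResiduallyOccurs K p σ) ∧
    (_Goal.stub_artinLift ↔
      ∀ (K : Type) [Field K] [NumberField K], IsTotallyComplex K → Module.finrank ℚ K = 2 →
        ∀ (p : ℕ) [Fact p.Prime] (σ : FramedGaloisRep K (PadicAlgCl p) 2),
          Finite σ.toMonoidHom.range → σ.toGaloisRep.IsIrreducible →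
            ResiduallyOccurs K p σ → Occurs K p σ) :=
  ⟨Iff.rfl, Iff.rfl⟩

/-! ## 3. Both stubs are consequences of the crux (so neither is harder than the crux) -/

/-- The crux gives STUB 2 (drop the residual hypothesis). [folklore] -/
theorem stub_artinLift_of_crux (h : ArtinPointsBianchi) : _Goal.stub_artinLift :=
  fun K _ _ hK hK2 p _ σ hfin hirr _ => h K hK hK2 p σ hfin hirr

/-- The crux gives STUB 1 (reduce the `t = 1` stage modulo `𝔪`, `residuallyOccurs_of_occurs`). [folklore] -/
theorem stub_serreK_of_crux (h : ArtinPointsBianchi) : _Goal.stub_serreK :=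
  fun K _ _ hK hK2 p _ σ hfin hirr => residuallyOccurs_of_occurs K p σ (h K hK hK2 p σ hfin hirr)

/-! ## 4. The composition (kernel-checked, no `sorry`): SERRE/K → LIFT → the crux by name -/

/-- **`ArtinPointsBianchi` from the two stubs.**  For `K, p, σ` as in the crux, `stub_serreK` gives the
residual occurrence of `σ̄` at some `S`-good level and `stub_artinLift` lifts it to the occurrence of `σ`.
The hypotheses are, by name, the statements of `stub_serreK` and `stub_artinLift`; the conclusion is the
route decl `Summit.Langlands.Langlands.Theses.RuelleTorsionArtinWeight.ArtinPointsBianchi`. [folklore] -/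
theorem ArtinPointsBianchi_of (h₁ : _Goal.stub_serreK) (h₂ : _Goal.stub_artinLift) :
    Summit.Langlands.Langlands.Theses.RuelleTorsionArtinWeight.ArtinPointsBianchi := by
  -- the stub statements, as the Π-types they literally are
  have hSerre : type_of% @stub_serreK := h₁
  have hLift : type_of% @stub_artinLift := h₂
  intro K _ _ hK hK2 p _ σ hfin hirr
  -- residual occurrence of `σ̄` (Serre/K) …
  have hres := hSerre K hK hK2 p σ hfin hirr
  -- … lifted to the occurrence of `σ` (pro-modularity lifting at the Artin point)
  exact hLift K hK hK2 p σ hfin hirr hres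

/-- By-name sanity check (an `example`, not a declaration of the file): the two stubs feed the
composition as they stand. -/
example : Summit.Langlands.Langlands.Theses.RuelleTorsionArtinWeight.ArtinPointsBianchi :=
  ArtinPointsBianchi_of stub_serreK stub_artinLift

end Summit.Langlands.Langlands.Cruxes.ArtinPointsBianchi.Birth

end
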